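import Summits.QuantumFields.BalabanUV.T4Continuum.Spine.NE5.TwoRunTorusWalkOutput
import Summits.QuantumFields.BalabanUV.T4Continuum.Spine.NE5.TwoRunTorusNE5Pencil

/-!
# Spine/NE5/TwoRunTorusNE5Terms — `T4OutputRate.NE5` BY NAME from per-scale, per-term (2.14)-PENCILS (§1) and from
# per-scale, per-term WALK RECORDS (§2), ONE theorem each (cell `pub-balaban-gaps`, seat `ne5` gen 11)

WHY.  The seat's mechanism chain on the papers' periodic carrier had three layers with a file each: per term, the
(2.14)-term is holomorphic along the two-run pencil with (2.26) uniform (T25 `TwoRunTorusWalkParam` ∕ T32 ∕ T35 — from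
ONE walk record + non-walk data); per scale, Lemma 3 and (2.39)–(2.41) turn the term families into the OUTPUT pencil
`b ↦ E_j^b(X)(φ)` holomorphic on the window with the (2.41) envelope (T17 `TwoRunTorusParam.differentiableOn_E_torus_param`);
across scales, the Schwarz step on the window `ball 0 (s∕θ^j)` and the one-run envelopes give `T4OutputRate.NE5` BY NAME
(T30 `TwoRunTorusNE5Pencil.ne5_of_output_pencils`).  THIS FILE composes the last two layers over ALL creation scales in ONE
theorem, `ne5_of_term_pencils_all_scales`: INPUT per scale `j` = the (2.14)-term pencil families `P j Z t φ b` of the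
`j`-th torus model with (a) each run's OWN (2.26) at the members `b = 0` (run A) and `b = 1` (run B) at every scale, and
(b) WHEREVER `θ^j < s`, holomorphy in `b` and (2.26) uniform on the window `ball 0 (s∕θ^j)`; plus Lemma 3's and
(2.39)–(2.41)'s numbers ONCE (the scale-independent constants `c`), the activities by summation and the outputs by (2.13).
OUTPUT = `T4OutputRate.NE5 (reFunctional E·⁰) (reFunctional E·¹) W′ ((1−10δ)½Lκ) θ (2A₂C₃ε₁∕s)` for every coupling window.
So the typed estimate NE5 is, on the carrier, ONE kernel implication from per-term pencil data; and the per-term pencil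
data are ONE kernel implication each from a walk record at `c⁺` admissible at the window size (T25; T35 for NODE O's
parametrix family with σ-holomorphy and NODE A's inputs free; the members' (2.26) alone: T31 `h226_of_termWalkData`).
The early scales (`s ≤ θ^j`) use no pencil: T17 is applied to the CONSTANT family at each member (each run's own Lemma 3).
§2 `ne5_of_termWalkData_all_scales` is the same END with the pencils READ FROM WALK RECORDS (T26
`TwoRunTorusWalkOutput.differentiableOn_E_torus_of_termWalkData` per scale, then T30): per scale `j` and per term, ONE
record `𝒦 j Z t φ : TermKernels c⁺ 4 (N j) ν (Nf j) ℂ` over the pencil with `TermWalkData (𝒦 j Z t φ) (w j)` for ONE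
package `w j` admissible at a size `α j > 1` with `s∕θ^j ≤ α j` wherever `θ^j < s` (the records' configuration radius
follows the two-run rate — rows NE2∕NE3), plus the NON-WALK data of T26 §1 per scale (σ-holomorphy of the kernels,
NODE A's symmetry ∕ `Re ≻ 0` and `SmallTheta (w j) (α j) ϑ` BY NAME, potentials with (2.20), `χ, χᶜ, 𝐃` with (2.22), a
column fibre bound, envelope letters, the p. 17 numerics) and Lemma 3's numbers once ⟹ the same `T4OutputRate.NE5`.  Its
binder list IS the row's gate list on the carrier: (v)⁺ records per term per scale (NODE O), the window (rows NE2∕NE3),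
the non-walk data (the NE5-side adapter); for NODE O's parametrix MODEL family σ-holomorphy and NODE A's inputs are
discharged per term by T35 and feed §1 instead.  (`θ` is the two-run RATE of T16∕T30; NODE A's smallness letter of
T25∕T26 is written `ϑ` here.)

HONEST FRAMING.  Pure composition of LANDED shapes (T17, T26, T30); every torus model, term family, record, region and
number is a HYPOTHESIS; nothing of Bałaban's `E^{(j)}`, `C^{(k)}(Z₀,σ)`, `Γ_k`, `𝐕_k` is constructed or asserted; whether Bałaban's two
runs admit such pencils with window `s∕θ^j` is NODE O's statement (v) together with rows NE2∕NE3's primitive two-run rate,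
not claimed here; NE5 NOT PRINTED ∕ NOT PROVED; leaves 0∕12; (D4) 0∕1; spine 0∕9.  Rung (B)+1 on a FIXED finite T⁴ — NOT
continuum, NOT infinite volume, NOT mass gap, NOT Clay.  HONEST DEPENDENCY: continuum YM on T⁴ ⇐ BetaPertH ∧ nine spine
estimates; BetaPertH ⇐ (D1) ∧ (D4) ∧ CAP+tail.  0 sorry, 0 `def`.

Sources: [I] = T. Bałaban, CMP **109** (1987) [Balaban1987RG1] (0.24)–(0.25) p. 257, (1.18) p. 263; [II] = CMP **116**
(1988) [Balaban1988RG2Cluster] (1.11) p. 5, p. 13, (2.13)–(2.26) pp. 14–17, Lemma 3 (2.38) p. 20, (2.41) p. 21; [B9] =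
CMP **99** (1985) [Balaban1985BackgroundPropagators] Thm 3.10 p. 416; C. King, CMP **102** (1986) [King1986] Thm 3.4
p. 656, p. 665; R. Kotecký–D. Preiss, CMP **103** (1986) [KoteckyPreiss1986] Thm 1.
Nothing here is a claim about the Yang–Mills mass gap.
-/

noncomputable section

namespace Summit.QuantumFields.BalabanUV.T4Continuum.Spine.NE5.TwoRunTorusNE5Terms

open Metric Set Finset
open Literature.MathematicalPhysics.QuantumFieldTheory.Balaban1983to89
open Literature.MathematicalPhysics.QuantumFieldTheory.Balaban1983to89.T4OutputRate (NE5)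
open Literature.MathematicalPhysics.QuantumFieldTheory.Balaban1983to89.TreeLengthTorus (TPt TDom tsys)
open Literature.MathematicalPhysics.QuantumFieldTheory.Balaban1983to89.TreeLengthTorusGeometry (TTouch)
open Literature.MathematicalPhysics.QuantumFieldTheory.Balaban1983to89.B13Lemma3TorusData (TBond)
open Literature.MathematicalPhysics.QuantumFieldTheory.Balaban1983to89.B13Lemma3Torus (TwoTorusStep)
open Literature.MathematicalPhysics.QuantumFieldTheory.Balaban1983to89.B13Lemma3TorusTerms (terms weight)
open Literature.MathematicalPhysics.QuantumFieldTheory.Balaban1983to89.B12TreeDecay (kappa₀ K₀)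
open Literature.MathematicalPhysics.QuantumFieldTheory.Balaban1983to89.B13Resummation (locE)
open Summit.QuantumFields.BalabanUV.T4Continuum.Spine.NE5.TwoRunTorusParam (differentiableOn_E_torus_param)
open Summit.QuantumFields.BalabanUV.T4Continuum.Spine.NE5.TwoRunTorusNE5 (torusCarriers reFunctional)
open Summit.QuantumFields.BalabanUV.T4Continuum.Spine.NE5.TwoRunTorusNE5Pencil (ne5_of_output_pencils)

variable {L : ℕ} [NeZero L] {M : ℕ} [NeZero M]

open Classical in
/-- **`T4OutputRate.NE5` BY NAME FROM PER-SCALE, PER-TERM (2.14)-PENCILS.**  Data: the scale-independent constants `c`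
(`8 ≤ L`), per creation scale `j` a torus model `W j` on the `N j`-torus and its (2.14)-term pencil families
`P j Z t φ : ℂ → ℂ` (run A = the member `0`, run B = the member `1`), a two-run rate `0 < θ` and margin `0 < s`.
Hypotheses: (a) at EVERY scale each member `b ∈ {0, 1}` satisfies (2.26) `‖P j Z t φ b‖ ≤ weight(Z,t)·e^{a₅|Z|}` on the
space (each run's own input of Lemma 3); (b) at every scale with `θ^j < s`, every `P j Z t φ` is complex differentiable on
the window `ball 0 (s∕θ^j)` with (2.26) uniform along it; (c) Lemma 3's restrictions and the (2.39)–(2.41) numbers at the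
torus constants, verbatim those of T17 `TwoRunTorusParam.differentiableOn_E_torus_param`, ONCE; (d) the activities
`H j b Z φ = Σ_{t ∈ terms Z} P j Z t φ b`, the space restriction of p. 15, and the outputs `E j b X φ` by (2.13) over the
torus incompatibility.  Conclusion: for every coupling window `W′`,
`NE5 (reFunctional N W (E · 0)) (reFunctional N W (E · 1)) W′ ((1−10δ)½Lκ) θ (2·(A₂C₃ε₁)∕s)` on the torus carriers —
the typed spine estimate BY NAME with rate `θ` and constant `C₅ = 2A₂C₃ε₁∕s`.  Proof: T17 per scale on the window (and,
for the members, on the constant family over `univ`), then T30.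
[cite: Balaban1987RG1, (0.24)–(0.25) p.257, (1.18) p.263; Balaban1988RG2Cluster, (2.13) p.14, (2.26) p.17, (2.38) p.20, (2.41) p.21; King1986, Thm 3.4 p.656, p.665] -/
theorem ne5_of_term_pencils_all_scales (c : B13.Consts) (hL : 8 ≤ c.L) (hLc : c.L = L)
    (N : ℕ → ℕ) [∀ j, NeZero (N j)] (W : (j : ℕ) → TwoTorusStep 4 L (N j))
    (P : (j : ℕ) → (Z : TDom 4 (N j)) → Finset (TDom 4 (L * N j)) × Finset (TBond 4 M (L * N j)) → (W j).Φ →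
      ℂ → ℂ)
    {θ s : ℝ} (hθ : 0 < θ) (hs : 0 < s) {a a₂ a₂' a₅ Aabs : ℝ}
    -- (a) each run's own (2.26) at every scale: the members `0` (run A) and `1` (run B)
    (h226runs : ∀ (j : ℕ), ∀ b₀ ∈ ({0, 1} : Set ℂ), ∀ (Z : TDom 4 (N j)) (φ : (W j).Φ), φ ∈ (W j).sp2 Z →
      ∀ t ∈ terms L M Z, ‖P j Z t φ b₀‖ ≤ weight L M c Z a t * Real.exp (a₅ * ((Z.1).card : ℝ)))
    -- (b) the pencil wherever the window `s∕θ^j` exceeds one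
    (hPhol : ∀ (j : ℕ), θ ^ j < s → ∀ (Z : TDom 4 (N j)) (φ : (W j).Φ), φ ∈ (W j).sp2 Z → ∀ t ∈ terms L M Z,
      DifferentiableOn ℂ (P j Z t φ) (ball (0 : ℂ) (s / θ ^ j)))
    (h226 : ∀ (j : ℕ), θ ^ j < s → ∀ b ∈ ball (0 : ℂ) (s / θ ^ j), ∀ (Z : TDom 4 (N j)) (φ : (W j).Φ),
      φ ∈ (W j).sp2 Z → ∀ t ∈ terms L M Z, ‖P j Z t φ b‖ ≤ weight L M c Z a t * Real.exp (a₅ * ((Z.1).card : ℝ)))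
    -- (c) Lemma 3's and (2.39)–(2.41)'s numbers, once (verbatim T17)
    (hα₆ : 0 < c.α₆) (hε₀ : 0 ≤ c.eps2) (hδ : 0 ≤ c.δ) (hδ7 : 0 ≤ 1 - 7 * c.δ) (hκ : 0 ≤ c.κ) (ha : 0 ≤ a)
    (hR15 : c.R15) (hR16 : 18 * ((1 - 4 * c.δ) * c.κ) ≤ a / 20) (hR16' : 4 * c.κ ≤ a / 20)
    (hR17 : Real.exp (-(a / 20)) ≤ c.eps2) (h231 : 2 * (4 : ℝ) * (M : ℝ) ^ 4 * Real.exp (-(a / 10)) ≤ a / 20)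
    (ha₂ : 0 ≤ a₂) (hκ229 : kappa₀ 64 8 + a₂ ≤ c.δ * c.κ)
    (hsm229 : c.α₆ * Real.exp a₂ * K₀ 64 8 * 64 ≤ a₂)
    (habsk : Real.exp (-(a / 20)) * 64 ≤ c.δ * c.κ)
    (h18half : B13Step237.R18half c (K₀ 64 8 * Real.exp (Real.exp (-(a / 20)) * 64)))
    (h18 : B13Step237.R18sharp c (K₀ 64 8 * Real.exp (Real.exp (-(a / 20)) * 64)) ((c.L : ℝ) / 2))
    (ha₂' : 0 ≤ a₂') (hκ229' : kappa₀ 64 8 + a₂' ≤ c.δ * ((c.L : ℝ) / 2) * c.κ)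
    (hsm229' : c.α₆ * Real.exp a₂' * K₀ 64 8 * 64 ≤ a₂')
    (hR20 : 18 * ((1 - 7 * c.δ) * ((c.L : ℝ) / 2) * c.κ) ≤ (c.κ₁ - 1) / 2)
    (ha₅ : 0 ≤ a₅) (habs : a₅ + Real.exp (-((c.κ₁ - 1) / 2)) ≤ Aabs)
    (hAc : Aabs * 64 ≤ c.δ * ((c.L : ℝ) / 2) * c.κ)
    (hC3 : B13Step237.bracketF c (K₀ 64 8 * Real.exp (Real.exp (-(a / 20)) * 64)) / c.α₆ *
      Real.exp (Aabs * 64) ≤ c.C3act * c.ε₁)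
    (hAct : 0 ≤ c.C3act * c.ε₁) (hr₁ : 0 ≤ (1 - 10 * c.δ) * ((c.L : ℝ) / 2) * c.κ)
    (hlarge : (1 - 10 * c.δ) * ((c.L : ℝ) / 2) * c.κ + 2 * (64 * Real.log 162) + 2 ≤
      (1 - 8 * c.δ) * ((c.L : ℝ) / 2) * c.κ)
    (hsmall : c.C3act * c.ε₁ * Real.exp (5 * ((1 - 10 * c.δ) * ((c.L : ℝ) / 2) * c.κ) + 1) * K₀ 64 8 * 9 * 64 ≤ 1)
    (hA₂ : Real.exp 1 * 9 * 64 * K₀ 64 8 ^ 2 ≤ c.A₂)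
    -- (d) activities by summation, space restriction, outputs by (2.13) — at every scale and member
    {H : (j : ℕ) → ℂ → TDom 4 (N j) → (W j).Φ → ℂ}
    (hH : ∀ (j : ℕ) (b : ℂ) (Z : TDom 4 (N j)) (φ : (W j).Φ), φ ∈ (W j).sp2 Z →
      H j b Z φ = ∑ t ∈ terms L M Z, P j Z t φ b)
    (hsp : ∀ (j : ℕ), ∀ X Z : TDom 4 (N j), ∀ φ, Z.1 ⊆ X.1 → φ ∈ (W j).sp2 X → φ ∈ (W j).sp2 Z)
    {E : (j : ℕ) → ℂ → TDom 4 (N j) → (W j).Φ → ℂ}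
    (h213 : ∀ (j : ℕ) (b : ℂ) (X : TDom 4 (N j)) (φ : (W j).Φ), φ ∈ (W j).sp2 X →
      E j b X φ = locE (TTouch (d := 4) (N := N j)) (fun Z : TDom 4 (N j) => Z.1) (fun Z => H j b Z φ) X.1)
    (W' : Set (ℕ → ℝ)) :
    NE5 (C := torusCarriers N W) (reFunctional N W fun j => E j 0) (reFunctional N W fun j => E j 1) W'
      ((1 - 10 * c.δ) * ((c.L : ℝ) / 2) * c.κ) θ (2 * (c.A₂ * c.C3act * c.ε₁) / s) := by
  -- the envelope constant is non-negative
  have hA : 0 ≤ c.A₂ * c.C3act * c.ε₁ := by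
    have hA₂0 : 0 ≤ c.A₂ := le_trans (by positivity) hA₂
    rw [mul_assoc]
    exact mul_nonneg hA₂0 hAct
  -- each run alone, every scale: T17 on the CONSTANT family at the member `b₀` over `univ` (no pencil needed)
  have hrun : ∀ (j : ℕ), ∀ b₀ ∈ ({0, 1} : Set ℂ), ∀ (X : TDom 4 (N j)) (φ : (W j).Φ), φ ∈ (W j).sp2 X →
      ‖E j b₀ X φ‖ ≤ c.A₂ * c.C3act * c.ε₁ *
        Real.exp (-((1 - 10 * c.δ) * ((c.L : ℝ) / 2) * c.κ * (tsys 4 (N j)).dj X)) := by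
    intro j b₀ hb₀ X φ hφ
    have key := differentiableOn_E_torus_param (B := ℂ) c hL hLc (W j) (fun Z t φ _ => P j Z t φ b₀) isOpen_univ
      (fun Z φ _ t _ => differentiableOn_const _) (fun _ _ Z φ hφ t ht => h226runs j b₀ hb₀ Z φ hφ t ht) hα₆ hε₀ hδ
      hδ7 hκ ha hR15 hR16 hR16' hR17 h231 ha₂ hκ229 hsm229 habsk h18half h18 ha₂' hκ229' hsm229' hR20 ha₅ habs hAc hC3
      (H := fun _ Z φ => H j b₀ Z φ) (fun _ _ Z φ hφ => hH j b₀ Z φ hφ) (hsp j) (E := fun _ X φ => E j b₀ X φ)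
      (fun _ _ X φ hφ => h213 j b₀ X φ hφ) hAct hr₁ hlarge hsmall hA₂
    exact (key X φ hφ).2 0 (mem_univ _)
  -- the pencil at the scales with `θ^j < s`: T17 on the window
  have hpen : ∀ (j : ℕ), θ ^ j < s → ∀ (X : TDom 4 (N j)) (φ : (W j).Φ), φ ∈ (W j).sp2 X →
      DifferentiableOn ℂ (fun b => E j b X φ) (ball (0 : ℂ) (s / θ ^ j)) ∧
        ∀ b ∈ ball (0 : ℂ) (s / θ ^ j), ‖E j b X φ‖ ≤ c.A₂ * c.C3act * c.ε₁ *
          Real.exp (-((1 - 10 * c.δ) * ((c.L : ℝ) / 2) * c.κ * (tsys 4 (N j)).dj X)) := fun j hj =>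
    differentiableOn_E_torus_param (B := ℂ) c hL hLc (W j) (P j) isOpen_ball (hPhol j hj) (h226 j hj) hα₆ hε₀ hδ
      hδ7 hκ ha hR15 hR16 hR16' hR17 h231 ha₂ hκ229 hsm229 habsk h18half h18 ha₂' hκ229' hsm229' hR20 ha₅ habs hAc hC3
      (H := H j) (fun b _ Z φ hφ => hH j b Z φ hφ) (hsp j) (E := E j) (fun b _ X φ hφ => h213 j b X φ hφ) hAct hr₁
      hlarge hsmall hA₂
  -- T30: the Schwarz step on the window + the one-run envelopes, all scales
  exact ne5_of_output_pencils N W E hA hθ hs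
    (fun j X φ hφ => ⟨hrun j 0 (by simp) X φ hφ, hrun j 1 (by simp) X φ hφ⟩) hpen W'

/-! ## §2. The same with the per-term pencils READ FROM WALK RECORDS at every scale (T26 §1 per scale, then T30) -/

section Records

open Matrix
open Literature.MathematicalPhysics.QuantumFieldTheory.Balaban1983to89.TreeLengthTorusTransfer (tclosure)
open Literature.MathematicalPhysics.QuantumFieldTheory.Balaban1983to89.B13Lemma3TorusTerms (Z0)
open Literature.MathematicalPhysics.QuantumFieldTheory.Balaban1983to89.B13Term214 (core214 F214 term214)
open Literature.MathematicalPhysics.QuantumFieldTheory.Balaban1983to89.B13Bound143 (invTau)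
open Literature.MathematicalPhysics.QuantumFieldTheory.Balaban1983to89.B5TorusCover (UT)
open Literature.MathematicalPhysics.QuantumFieldTheory.Balaban1983to89.B13TermWalkData
  (WalkConsts TermKernels TermWalkData)
open Literature.MathematicalPhysics.QuantumFieldTheory.Balaban1983to89.B13TermWalkDataOneTorus (SmallTheta)
open Summit.QuantumFields.BalabanUV.T4Continuum.Spine.NE5.TwoRunTorusWalkOutput
  (differentiableOn_E_torus_of_termWalkData)

variable {ν : ℕ} {Nf : ℕ → Fin ν → ℕ} [∀ j i, NeZero (Nf j i)]

open Classical in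
/-- **`T4OutputRate.NE5` BY NAME FROM PER-SCALE, PER-TERM WALK RECORDS AT `c⁺`** (§1 with the pencils read from
records: T26 `TwoRunTorusWalkOutput.differentiableOn_E_torus_of_termWalkData` per scale, then T30).  Data per creation
scale `j`: the torus model `W j` on the `N j`-torus with its τ-regions and lists, and — per term `(Z, t)` and
configuration `φ ∈ sp2 Z` — ONE walk record `𝒦 j Z t φ : TermKernels c⁺ 4 (N j) ν (Nf j) ℂ` over the PENCIL parameter
space `ℂ` (run A = `b = 0`, run B = `b = 1`) with `TermWalkData (𝒦 j Z t φ) (w j)` for ONE package `w j` per scale,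
admissible at a size `α j` with `1 < α j` and `s∕θ^j ≤ α j` wherever `θ^j < s` (the WINDOW: the records' configuration
radius must follow the two-run rate — rows NE2∕NE3); the NON-WALK data per scale exactly as in T26 §1 (the Γ-operator
linear with the record's kernel, σ-holomorphy of the record's kernels, NODE A's symmetry ∕ `Re ≻ 0`, potentials with
(2.20), common `χ, χᶜ, 𝐃` with (2.22), a column fibre bound, the envelope letters `cE, g`, NODE A's `SmallTheta (w j) (α j) ϑ`
BY NAME and the p. 17 numerics in the records' letters); Lemma 3's and (2.39)–(2.41)'s numbers ONCE; activities by
summation of the records' (2.14)-terms, outputs by (2.13).  Conclusion: §1's — `NE5 (reFunctional N W (E · 0))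
(reFunctional N W (E · 1)) W′ ((1−10δ)½Lκ) θ (2·(A₂C₃ε₁)∕s)` for every coupling window.  The binder list of this theorem
IS the row's gate list on the carrier: (v)⁺ records per term per scale (NODE O), the window `s∕θ^j` (rows NE2∕NE3), and
the non-walk data (the NE5-side adapter).
[cite: Balaban1987RG1, (0.24)–(0.25) p.257, (1.18) p.263; Balaban1988RG2Cluster, (1.11) p.5, p.13, p.15, (2.13)–(2.26) pp.14–17, (2.38) p.20, (2.41) p.21; Balaban1985BackgroundPropagators, Thm 3.10 p.416; King1986, Thm 3.4 p.656, p.665] -/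
theorem ne5_of_termWalkData_all_scales (c : B13.Consts) (hL : 8 ≤ c.L) (hLc : c.L = L) (hκ₁ : 1 ≤ c.κ₁)
    (hα₆' : c.α₆ ≠ 0) (N : ℕ → ℕ) [∀ j, NeZero (N j)] (W : (j : ℕ) → TwoTorusStep 4 L (N j))
    {θ s : ℝ} (hθ : 0 < θ) (hs : 0 < s)
    -- regions, radii, contour radius, parameter lists, per scale
    (hpos : ∀ j, ∀ Y : TDom 4 (L * N j), 0 < invTau c ((tsys 4 (L * N j)).dj Y))
    (hhalf : ∀ j, ∀ Y : TDom 4 (L * N j), invTau c ((tsys 4 (L * N j)).dj Y) ≤ 1 / 2)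
    {Uτ : (j : ℕ) → TDom 4 (L * N j) → Set ℂ} (hUτ : ∀ j Y, IsOpen (Uτ j Y))
    (hUtau : ∀ j, ∀ Y : TDom 4 (L * N j), closedBall (0 : ℂ) ((invTau c ((tsys 4 (L * N j)).dj Y))⁻¹) ⊆ Uτ j Y)
    {r : ℝ} (hr : 0 < r) (hr' : r ≤ Real.exp c.κ₁ - 1)
    (hsubτ : ∀ j Y, ∀ ζ ∈ Set.uIcc (0 : ℝ) 1, closedBall (ζ : ℂ) r ⊆ Uτ j Y)
    (lZ : (j : ℕ) → TDom 4 (N j) → Finset (TDom 4 (L * N j)) × Finset (TBond 4 M (L * N j)) → List (TPt 4 (N j)))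
    (hlZ : ∀ j Z t, (lZ j Z t).Nodup ∧ (lZ j Z t).toFinset = Z.1 \ tclosure L (N j) (Z0 M t))
    (lD : (j : ℕ) → Finset (TDom 4 (L * N j)) × Finset (TBond 4 M (L * N j)) → List (TDom 4 (L * N j)))
    (hlD : ∀ j t, (lD j t).Nodup ∧ (lD j t).toFinset = t.1)
    -- PER-SCALE, PER-TERM WALK RECORDS AT `c⁺` OVER THE PENCIL, ONE ADMISSIBLE PACKAGE PER SCALE AT THE WINDOW SIZE
    (𝒦 : (j : ℕ) → (Z : TDom 4 (N j)) → Finset (TDom 4 (L * N j)) × Finset (TBond 4 M (L * N j)) → (W j).Φ →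
      TermKernels ({ c with κ₁ := c.κ₁ + 1 } : B13.Consts) 4 (N j) ν (Nf j) ℂ)
    [∀ j Z t φ, Fintype (𝒦 j Z t φ).C₀] [∀ j Z t φ, DecidableEq (𝒦 j Z t φ).C₀]
    {w : ℕ → WalkConsts} {α Rσ₀ : ℕ → ℝ} (hw : ∀ j, (w j).Admissible (α j) (Rσ₀ j))
    (hα1 : ∀ j, 1 < α j) (hαs : ∀ j, θ ^ j < s → s / θ ^ j ≤ α j)
    (h𝒦 : ∀ j Z, ∀ t ∈ terms L M Z, ∀ φ, φ ∈ (W j).sp2 Z → TermWalkData (𝒦 j Z t φ) (w j))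
    (Γ : (j : ℕ) → (Z : TDom 4 (N j)) → (t : Finset (TDom 4 (L * N j)) × Finset (TBond 4 M (L * N j))) →
      (φ : (W j).Φ) → ℂ → (TPt 4 (N j) → ℂ) → ((𝒦 j Z t φ).Λ ⊕ (𝒦 j Z t φ).C₀ → ℝ) → ((𝒦 j Z t φ).Λ → ℂ))
    (hlin : ∀ j Z, ∀ t ∈ terms L M Z, ∀ φ, φ ∈ (W j).sp2 Z → ∀ b ∈ ball (0 : ℂ) (α j), ∀ σ : TPt 4 (N j) → ℂ,
      (∀ i, σ i ∈ ball (0 : ℂ) (Real.exp (c.κ₁ + 1))) →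
        ∀ X : (𝒦 j Z t φ).Λ ⊕ (𝒦 j Z t φ).C₀ → ℝ, Γ j Z t φ b σ X = (𝒦 j Z t φ).G2 σ b *ᵥ fun i => (X i : ℂ))
    (χY₀ χcP : (j : ℕ) → (Z : TDom 4 (N j)) → (t : Finset (TDom 4 (L * N j)) × Finset (TBond 4 M (L * N j))) →
      (φ : (W j).Φ) → ((𝒦 j Z t φ).Λ → ℝ) → ℝ)
    (hχ0 : ∀ j Z t φ Bf, 0 ≤ χY₀ j Z t φ Bf) (hχc0 : ∀ j Z t φ Bf, 0 ≤ χcP j Z t φ Bf)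
    (Dfam : (j : ℕ) → TDom 4 (N j) → Finset (TDom 4 (L * N j)) × Finset (TBond 4 M (L * N j)) →
      Finset (TDom 4 (L * N j)))
    (Vk : (j : ℕ) → (Z : TDom 4 (N j)) → (t : Finset (TDom 4 (L * N j)) × Finset (TBond 4 M (L * N j))) →
      (φ : (W j).Φ) → ℂ → TDom 4 (L * N j) → ((𝒦 j Z t φ).Λ → ℝ) → ℂ)
    -- non-walk data per scale: σ-holomorphy (NODE O), symmetry ∕ `Re ≻ 0` (NODE A), potentials, measurability
    (hAhol : ∀ j Z, ∀ t ∈ terms L M Z, ∀ φ, φ ∈ (W j).sp2 Z → ∀ b ∈ ball (0 : ℂ) (α j), ∀ i i',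
      DifferentiableOn ℂ (fun σ => (𝒦 j Z t φ).A2 σ b i i')
        {σ | ∀ i, σ i ∈ ball (0 : ℂ) (Real.exp (c.κ₁ + 1))})
    (hGhol : ∀ j Z, ∀ t ∈ terms L M Z, ∀ φ, φ ∈ (W j).sp2 Z → ∀ b ∈ ball (0 : ℂ) (α j), ∀ i i',
      DifferentiableOn ℂ (fun σ => (𝒦 j Z t φ).G2 σ b i i')
        {σ | ∀ i, σ i ∈ ball (0 : ℂ) (Real.exp (c.κ₁ + 1))})
    (hVholb : ∀ j Z, ∀ t ∈ terms L M Z, ∀ φ, φ ∈ (W j).sp2 Z → ∀ Y Bf,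
      DifferentiableOn ℂ (fun b => Vk j Z t φ b Y Bf) (ball (0 : ℂ) (α j)))
    (hχm : ∀ j Z t φ, Measurable (χY₀ j Z t φ)) (hχcm : ∀ j Z t φ, Measurable (χcP j Z t φ))
    (hVm : ∀ j Z, ∀ t ∈ terms L M Z, ∀ φ, φ ∈ (W j).sp2 Z → ∀ b ∈ ball (0 : ℂ) (α j), ∀ Y,
      Measurable (Vk j Z t φ b Y))
    (hAs : ∀ j Z, ∀ t ∈ terms L M Z, ∀ φ, φ ∈ (W j).sp2 Z → ∀ b : ℂ, ‖b‖ ≤ α j → ∀ σ : TPt 4 (N j) → ℂ,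
      (∀ i, ‖σ i‖ ≤ Real.exp (c.κ₁ + 1)) → ((𝒦 j Z t φ).A2 σ b).IsSymm)
    (hA : ∀ j Z, ∀ t ∈ terms L M Z, ∀ φ, φ ∈ (W j).sp2 Z → ∀ b : ℂ, ‖b‖ ≤ α j → ∀ σ : TPt 4 (N j) → ℂ,
      (∀ i, ‖σ i‖ ≤ Real.exp (c.κ₁ + 1)) → (((𝒦 j Z t φ).A2 σ b).map Complex.re).PosDef)
    -- (2.22) and (2.20), uniform along the pencil, per scale
    {γ₂ rP a₂₀ w₂₀ : ℝ}
    (qP : (j : ℕ) → (Z : TDom 4 (N j)) → (t : Finset (TDom 4 (L * N j)) × Finset (TBond 4 M (L * N j))) →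
      (φ : (W j).Φ) → ((𝒦 j Z t φ).Λ → ℝ) → ℝ)
    (h222 : ∀ j Z t φ Bf, χY₀ j Z t φ Bf * χcP j Z t φ Bf ≤
      Real.exp (-(γ₂ / 2 * rP ^ 2 * (t.2.card : ℕ)) + γ₂ / 2 * qP j Z t φ Bf))
    (hγ₂ : 0 ≤ γ₂) (hqP : ∀ j Z t φ Bf, qP j Z t φ Bf ≤ Bf ⬝ᵥ Bf) (ha0 : 0 ≤ a₂₀)
    (h220U : ∀ j Z, ∀ t ∈ terms L M Z, ∀ φ, φ ∈ (W j).sp2 Z → ∀ b ∈ ball (0 : ℂ) (α j),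
      ∀ τ : TDom 4 (L * N j) → ℂ, (∀ Y, τ Y ∈ Uτ j Y) →
        ∀ Bf, ∑ Y ∈ Dfam j Z t, ‖τ Y‖ * ‖Vk j Z t φ b Y Bf‖ ≤ a₂₀ / 2 * (Bf ⬝ᵥ Bf) + w₂₀)
    -- a common fibre bound
    {m : ℕ} (hm : ∀ j Z t φ, (𝒦 j Z t φ).m ≤ m)
    (hfibN : ∀ j Z t φ, ∀ x : UT (Nf j), (Finset.univ.filter fun i => (𝒦 j Z t φ).locN i = x).card ≤ m)
    -- one package of rates, NODE A's smallness `ϑ` BY NAME per scale, the p. 17 numerics in the records' letters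
    {κa κb kap' kap'' ϑ : ℝ} (hκa : ∀ j, κa < (w j).kap) (hκb : κb < κa) (h2 : kap' < κb) (h1 : kap'' < kap')
    (hkap'' : 0 < kap'')
    (hsm : ∀ j, SmallTheta (w j) (α j) ϑ)
    (hθR1le : ∀ j Z t φ, ((m : ℝ) * (1 + 2 / (κb - kap')) ^ ν) * (m * (1 + 2 / (kap' - kap'')) ^ ν)
      * ((2 * (w j).KbarΓ * Real.exp (-((w j).ε * (w j).Rσ)) + 2 * (w j).KbarΓ * α j / (w j).R) * (w j).KbarC
          * (w j).KbarΓ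
        + (w j).KbarΓ * ((w j).KbarC * (2 * (w j).KbarE * Real.exp (-((w j).ε * (w j).Rσ))
            + 2 * (w j).KbarE * α j / (w j).R)
            * ((𝒦 j Z t φ).m * (1 + 2 / ((w j).kap - κa)) ^ ν) * (w j).KbarC
            * ((𝒦 j Z t φ).m * (1 + 2 / (κa - κb)) ^ ν)) * (w j).KbarΓ
        + (w j).KbarΓ * (w j).KbarC * (2 * (w j).KbarΓ * Real.exp (-((w j).ε * (w j).Rσ))
            + 2 * (w j).KbarΓ * α j / (w j).R)) ≤ ϑ)
    (hsmallKθ : ∀ j, (w j).KbarC * (m * (1 + 2 / κb) ^ ν) * (ϑ * (m * (1 + 2 / kap'') ^ ν)) < 1)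
    {cE g : ℝ} (hc0 : 0 ≤ cE) (hc : ∀ j Z t φ k, (𝒦 j Z t φ).hC.1.eigenvalues k ≤ cE)
    (hαc : (2 * (ϑ * (m * (1 + 2 / kap'') ^ ν)) + (γ₂ + a₂₀)) * cE ≤ 1 / 2) (hg : 0 ≤ g)
    (hΓq : ∀ j Z, ∀ t ∈ terms L M Z, ∀ φ, φ ∈ (W j).sp2 Z → ∀ X : (𝒦 j Z t φ).Λ ⊕ (𝒦 j Z t φ).C₀ → ℝ,
      ((𝒦 j Z t φ).Γ₀ *ᵥ X) ⬝ᵥ ((𝒦 j Z t φ).C *ᵥ ((𝒦 j Z t φ).Γ₀ *ᵥ X)) ≤ g * (X ⬝ᵥ X))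
    (hsmall : (2 * (ϑ * (m * (1 + 2 / kap'') ^ ν)) + (γ₂ + a₂₀)) * (1 + 2 * cE * g) ≤ 1 / 2)
    {a a₅ : ℝ} (hPa : a ≤ γ₂ * rP ^ 2)
    (hvol : ∀ j Z, ∀ t ∈ terms L M Z, ∀ φ, φ ∈ (W j).sp2 Z →
      2 * ((w j).KbarC * (m * (1 + 2 / κb) ^ ν) * (ϑ * (m * (1 + 2 / kap'') ^ ν))
              * (1 + (1 - (w j).KbarC * (m * (1 + 2 / κb) ^ ν) * (ϑ * (m * (1 + 2 / kap'') ^ ν)))⁻¹) / 2)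
          * (Fintype.card (𝒦 j Z t φ).Λ : ℝ)
        + w₂₀ + (2 * (ϑ * (m * (1 + 2 / kap'') ^ ν)) + (γ₂ + a₂₀)) * cE * (Fintype.card (𝒦 j Z t φ).Λ : ℝ)
        + (2 * (ϑ * (m * (1 + 2 / kap'') ^ ν)) + (γ₂ + a₂₀)) * (1 + 2 * cE * g)
          * (Fintype.card ((𝒦 j Z t φ).Λ ⊕ (𝒦 j Z t φ).C₀) : ℝ)
        ≤ a₅ * ((Z.1).card : ℝ))
    -- Lemma 3's and (2.39)–(2.41)'s numbers, once (verbatim T17)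
    {a₂ a₂' Aabs : ℝ}
    (hα₆ : 0 < c.α₆) (hε₀ : 0 ≤ c.eps2) (hδ : 0 ≤ c.δ) (hδ7 : 0 ≤ 1 - 7 * c.δ) (hκ : 0 ≤ c.κ) (ha : 0 ≤ a)
    (hR15 : c.R15) (hR16 : 18 * ((1 - 4 * c.δ) * c.κ) ≤ a / 20) (hR16' : 4 * c.κ ≤ a / 20)
    (hR17 : Real.exp (-(a / 20)) ≤ c.eps2) (h231 : 2 * (4 : ℝ) * (M : ℝ) ^ 4 * Real.exp (-(a / 10)) ≤ a / 20)
    (ha₂ : 0 ≤ a₂) (hκ229 : kappa₀ 64 8 + a₂ ≤ c.δ * c.κ)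
    (hsm229 : c.α₆ * Real.exp a₂ * K₀ 64 8 * 64 ≤ a₂)
    (habsk : Real.exp (-(a / 20)) * 64 ≤ c.δ * c.κ)
    (h18half : B13Step237.R18half c (K₀ 64 8 * Real.exp (Real.exp (-(a / 20)) * 64)))
    (h18 : B13Step237.R18sharp c (K₀ 64 8 * Real.exp (Real.exp (-(a / 20)) * 64)) ((c.L : ℝ) / 2))
    (ha₂' : 0 ≤ a₂') (hκ229' : kappa₀ 64 8 + a₂' ≤ c.δ * ((c.L : ℝ) / 2) * c.κ)
    (hsm229' : c.α₆ * Real.exp a₂' * K₀ 64 8 * 64 ≤ a₂')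
    (hR20 : 18 * ((1 - 7 * c.δ) * ((c.L : ℝ) / 2) * c.κ) ≤ (c.κ₁ - 1) / 2)
    (ha₅ : 0 ≤ a₅) (habs : a₅ + Real.exp (-((c.κ₁ - 1) / 2)) ≤ Aabs)
    (hAc : Aabs * 64 ≤ c.δ * ((c.L : ℝ) / 2) * c.κ)
    (hC3 : B13Step237.bracketF c (K₀ 64 8 * Real.exp (Real.exp (-(a / 20)) * 64)) / c.α₆ *
      Real.exp (Aabs * 64) ≤ c.C3act * c.ε₁)
    -- the members' activities are the sums of the (2.14)-terms read from the records; (2.13); space restriction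
    {H : (j : ℕ) → ℂ → TDom 4 (N j) → (W j).Φ → ℂ}
    (hH : ∀ j, ∀ b ∈ ball (0 : ℂ) (α j), ∀ (Z : TDom 4 (N j)) (φ : (W j).Φ), φ ∈ (W j).sp2 Z →
      H j b Z φ = ∑ t ∈ terms L M Z,
        term214 r (lZ j Z t) (lD j t) (core214 (fun σ => (𝒦 j Z t φ).A2 σ b) (Γ j Z t φ b)
          (F214 t.2.card (χY₀ j Z t φ) (χcP j Z t φ) (Dfam j Z t) (Vk j Z t φ b))) 0 0)
    (hsp : ∀ j, ∀ X Z : TDom 4 (N j), ∀ φ, Z.1 ⊆ X.1 → φ ∈ (W j).sp2 X → φ ∈ (W j).sp2 Z)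
    {E : (j : ℕ) → ℂ → TDom 4 (N j) → (W j).Φ → ℂ}
    (h213 : ∀ j, ∀ b ∈ ball (0 : ℂ) (α j), ∀ (X : TDom 4 (N j)) (φ : (W j).Φ), φ ∈ (W j).sp2 X →
      E j b X φ = locE (TTouch (d := 4) (N := N j)) (fun Z : TDom 4 (N j) => Z.1) (fun Z => H j b Z φ) X.1)
    (hAct : 0 ≤ c.C3act * c.ε₁) (hr₁ : 0 ≤ (1 - 10 * c.δ) * ((c.L : ℝ) / 2) * c.κ)
    (hlarge : (1 - 10 * c.δ) * ((c.L : ℝ) / 2) * c.κ + 2 * (64 * Real.log 162) + 2 ≤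
      (1 - 8 * c.δ) * ((c.L : ℝ) / 2) * c.κ)
    (hsmall41 : c.C3act * c.ε₁ * Real.exp (5 * ((1 - 10 * c.δ) * ((c.L : ℝ) / 2) * c.κ) + 1) * K₀ 64 8 * 9 * 64 ≤ 1)
    (hA₂ : Real.exp 1 * 9 * 64 * K₀ 64 8 ^ 2 ≤ c.A₂) (W' : Set (ℕ → ℝ)) :
    NE5 (C := torusCarriers N W) (reFunctional N W fun j => E j 0) (reFunctional N W fun j => E j 1) W'
      ((1 - 10 * c.δ) * ((c.L : ℝ) / 2) * c.κ) θ (2 * (c.A₂ * c.C3act * c.ε₁) / s) := by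
  -- the envelope constant is non-negative
  have hAp : 0 ≤ c.A₂ * c.C3act * c.ε₁ := by
    have hA₂0 : 0 ≤ c.A₂ := le_trans (by positivity) hA₂
    rw [mul_assoc]
    exact mul_nonneg hA₂0 hAct
  -- T26 §1 at every scale: the output pencil on `ball 0 (α j)` from the records
  have key : ∀ (j : ℕ) (X : TDom 4 (N j)) (φ : (W j).Φ), φ ∈ (W j).sp2 X →
      DifferentiableOn ℂ (fun b => E j b X φ) (ball (0 : ℂ) (α j)) ∧
        ∀ b ∈ ball (0 : ℂ) (α j), ‖E j b X φ‖ ≤ c.A₂ * c.C3act * c.ε₁ *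
          Real.exp (-((1 - 10 * c.δ) * ((c.L : ℝ) / 2) * c.κ * (tsys 4 (N j)).dj X)) := fun j =>
    differentiableOn_E_torus_of_termWalkData c hL hLc hκ₁ hα₆' (W j) (hpos j) (hhalf j) (hUτ j) (hUtau j) hr hr'
      (hsubτ j) (lZ j) (hlZ j) (lD j) (hlD j) (𝒦 j) (hw j) (one_pos.trans (hα1 j)) (h𝒦 j) (Γ j) (hlin j) (χY₀ j)
      (χcP j) (hχ0 j) (hχc0 j) (Dfam j) (Vk j) (hAhol j) (hGhol j) (hVholb j) (hχm j) (hχcm j) (hVm j) (hAs j)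
      (hA j) (qP j) (h222 j) hγ₂ (hqP j) ha0 (h220U j) (hm j) (hfibN j) (hκa j) hκb h2 h1 hkap'' (hsm j)
      (hθR1le j) (hsmallKθ j) hc0 (hc j) hαc hg (hΓq j) hsmall hPa (hvol j) hα₆ hε₀ hδ hδ7 hκ ha hR15 hR16 hR16'
      hR17 h231 ha₂ hκ229 hsm229 habsk h18half h18 ha₂' hκ229' hsm229' hR20 ha₅ habs hAc hC3 (hH j) (hsp j) (h213 j)
      hAct hr₁ hlarge hsmall41 hA₂
  -- T30: the members at every scale, the window where `θ^j < s`
  refine ne5_of_output_pencils N W E hAp hθ hs (fun j X φ hφ => ?_) (fun j hj X φ hφ => ?_) W'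
  · exact ⟨(key j X φ hφ).2 0 (mem_ball_self (one_pos.trans (hα1 j))),
      (key j X φ hφ).2 1 (by simpa using hα1 j)⟩
  · exact ⟨(key j X φ hφ).1.mono (ball_subset_ball (hαs j hj)),
      fun b hb => (key j X φ hφ).2 b (ball_subset_ball (hαs j hj) hb)⟩

end Records

end Summit.QuantumFields.BalabanUV.T4Continuum.Spine.NE5.TwoRunTorusNE5Terms

end
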